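import Mathlib
import Literature.Computability.AlgebraicComplexity.DegenerationSpectralMonotone
import Literature.Computability.AlgebraicComplexity.AsymptoticRankMatMul
import Literature.Barriers.MatrixMultiplication.RectangularBarrier
import HarnessLib

/-!
# Block count ⇒ spectral rate — stub `stub_blockRate` of line `birth`
(crux `OctSpectralDominance`, stmt-MatrixMultiplication-7931)

A general extraction lemma of Strassen's spectral calculus.  If for every level `k ≥ 1` the
`k`-th Kronecker power of a tensor `t` over `ℂ` degenerates (over `ℂ[ε]`, `AlgDegeneratesTo`) to
`m_k` independent copies of `⟨n^k, n^k, n^k⟩`, i.e. to `⟨m_k⟩ ⊗ ⟨n^k,n^k,n^k⟩`, with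
`β^k ≤ C (k+1)^d m_k`, then every universal spectral point `F` over `ℂ` satisfies
`β · F(⟨n,n,n⟩) ≤ F(t)`.

Proof (per level `k ≥ 1`, with `φ := F ⟨n,n,n⟩ ≥ 0`, `τ := F t ≥ 0`):
`F(t)^k = F(t^⊠k) ≥ F(⟨m_k⟩ ⊗ ⟨n^k,n^k,n^k⟩) = m_k · F ⟨n^k,n^k,n^k⟩ ≥ m_k · F(⟨n,n,n⟩^⊠k) = m_k φ^k`
(`IsUniversalSpectralPoint.map_kroneckerPow`, `mono_of_algDegeneratesTo`, `map_kronecker`,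
`map_unitTensor`, and monotonicity along `tensorRestrictsTo_matMulTensor_pow_kroneckerPow`).
Hence `(βφ)^k ≤ C (k+1)^d m_k φ^k ≤ max C 1 · (k+1)^d · τ^k` for `k ≥ 1` and trivially for
`k = 0`; `le_of_forall_pow_le_polynomial_mul_pow` then gives `β φ ≤ τ`.
-/

set_option linter.dupNamespace false
-- (single-conjunct summit: the namespace repeats `MatrixMultiplication`)

namespace Summit.MatrixMultiplication.MatrixMultiplication.Theorems

open Literature.Computability.AlgebraicComplexity

/-- **Block count ⇒ spectral rate** (registered stub `stub_blockRate` of line `birth`; Strassen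
calculus).  If the Kronecker powers of a tensor `t` over `ℂ` degenerate to `m_k` independent
`⟨n^k,n^k,n^k⟩`-blocks with `β^k ≤ C (k+1)^d m_k` for every `k ≥ 1`, then every universal
spectral point `F` over `ℂ` has `β · F(⟨n,n,n⟩) ≤ F(t)`.  Per level,
`m_k F(⟨n,n,n⟩)^k = F(⟨m_k⟩) F(⟨n,n,n⟩^⊠k) ≤ F(⟨m_k⟩ ⊗ ⟨n^k,n^k,n^k⟩) ≤ F(t^⊠k) = F(t)^k`, then
`k → ∞` through `le_of_forall_pow_le_polynomial_mul_pow` with the constant `max C 1`.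
[cite: Strassen1988, §3] -/
theorem stub_blockRate :
    ∀ (ι κ μ : Type) [Fintype ι] [Fintype κ] [Fintype μ] (t : ι → κ → μ → ℂ) (n : ℕ) (β C : ℝ) (d : ℕ),
      (∀ k : ℕ, 1 ≤ k → ∃ m : ℕ, β ^ k ≤ C * ((k : ℝ) + 1) ^ d * (m : ℝ) ∧
        AlgDegeneratesTo (kroneckerPow t k)
          (kroneckerTensor (unitTensor ℂ m) (matMulTensor ℂ (n ^ k) (n ^ k) (n ^ k)))) →
      ∀ F : SpectralMap ℂ, IsUniversalSpectralPoint ℂ F → β * F (matMulTensor ℂ n n n) ≤ F t := by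
  intro ι κ μ _ _ _ t n β C d hdeg F hF
  have hφ0 : 0 ≤ F (matMulTensor ℂ n n n) := hF.nonneg _
  have hτ0 : 0 ≤ F t := hF.nonneg _
  have hmax0 : (0 : ℝ) ≤ max C 1 := zero_le_one.trans (le_max_right C 1)
  refine le_of_forall_pow_le_polynomial_mul_pow (β * F (matMulTensor ℂ n n n)) (F t) (max C 1) d
    hτ0 fun k => ?_
  rcases Nat.eq_zero_or_pos k with rfl | hk
  · -- level `0`: `1 ≤ max C 1`
    simp only [pow_zero, Nat.cast_zero, zero_add, one_pow, mul_one]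
    exact le_max_right C 1
  obtain ⟨m, hm, hd⟩ := hdeg k hk
  -- `F(⟨m⟩ ⊗ ⟨n^k,n^k,n^k⟩) ≤ F(t^⊠k) = F(t)^k`
  have h1 : F (kroneckerTensor (unitTensor ℂ m) (matMulTensor ℂ (n ^ k) (n ^ k) (n ^ k))) ≤
      F t ^ k := by
    rw [← hF.map_kroneckerPow t k]
    exact hF.mono_of_algDegeneratesTo hd
  rw [hF.map_kronecker, hF.map_unitTensor] at h1
  -- `F(⟨n,n,n⟩)^k = F(⟨n,n,n⟩^⊠k) ≤ F ⟨n^k,n^k,n^k⟩`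
  have h2 : F (matMulTensor ℂ n n n) ^ k ≤ F (matMulTensor ℂ (n ^ k) (n ^ k) (n ^ k)) := by
    rw [← hF.map_kroneckerPow (matMulTensor ℂ n n n) k]
    exact hF.mono _ _ (tensorRestrictsTo_matMulTensor_pow_kroneckerPow ℂ n n n k)
  -- `m · F(⟨n,n,n⟩)^k ≤ F(t)^k`
  have h3 : (m : ℝ) * F (matMulTensor ℂ n n n) ^ k ≤ F t ^ k :=
    (mul_le_mul_of_nonneg_left h2 (Nat.cast_nonneg m)).trans h1
  have hφk : 0 ≤ F (matMulTensor ℂ n n n) ^ k := pow_nonneg hφ0 k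
  have hkd : (0 : ℝ) ≤ ((k : ℝ) + 1) ^ d := by positivity
  have hX : (0 : ℝ) ≤ ((k : ℝ) + 1) ^ d * ((m : ℝ) * F (matMulTensor ℂ n n n) ^ k) :=
    mul_nonneg hkd (mul_nonneg (Nat.cast_nonneg m) hφk)
  calc (β * F (matMulTensor ℂ n n n)) ^ k
      = β ^ k * F (matMulTensor ℂ n n n) ^ k := mul_pow β _ k
    _ ≤ C * ((k : ℝ) + 1) ^ d * (m : ℝ) * F (matMulTensor ℂ n n n) ^ k :=
        mul_le_mul_of_nonneg_right hm hφk
    _ = C * (((k : ℝ) + 1) ^ d * ((m : ℝ) * F (matMulTensor ℂ n n n) ^ k)) := by ring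
    _ ≤ max C 1 * (((k : ℝ) + 1) ^ d * ((m : ℝ) * F (matMulTensor ℂ n n n) ^ k)) :=
        mul_le_mul_of_nonneg_right (le_max_left C 1) hX
    _ ≤ max C 1 * (((k : ℝ) + 1) ^ d * F t ^ k) :=
        mul_le_mul_of_nonneg_left (mul_le_mul_of_nonneg_left h3 hkd) hmax0
    _ = max C 1 * ((k : ℝ) + 1) ^ d * F t ^ k := by ring

end Summit.MatrixMultiplication.MatrixMultiplication.Theorems
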